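import Literature.NumberTheory.GelbartRogawski1991.LocalMpGaloisTwist
import Literature.NumberTheory.GelbartRogawski1991.LocalMpAddCharRescaling
import Literature.RepresentationTheory.TwistedCoinvariantsCentralCharacterQuotient
import HarnessLib

/-!
# Galois twist followed by rescaling: `S̃p_{ψ_v}(𝕎_v, β_T) → S̃p_{ψ_v(κ·)}(𝕎_v, β_T) ≃ S̃p_{ψ_v}(𝕎_v, β_{tT})`

Topic `NumberTheory/GelbartRogawski1991`; namespace `Literature.NumberTheory.GelbartRogawski1991.UnitaryDualPair.LocalSplitting`.
KERNEL mathematics only (theorems; no definition, no named fact, no `sorry`).  Cell hodgecm-mathlib, row III-11, the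
composite of road pieces **P3a** (`LocalMp.galTwist`, file `LocalMpGaloisTwist`: the twist of the local metaplectic group
of pairs by a field automorphism `τ` of `ℂ` with inverse `τ′`, `τ ∘ ψ_v = ψ_v(κ·)`) and **P4** (`exists_mpPsi_equiv_localMp_of_sq_mul_eq`,
file `LocalMpAddCharRescaling`: the `ψ_v(κ·)`-package of `β_T` is the `ψ_v`-package of `β_{tT}` for `κ = s²t`, up to the dilation
`D_s`), stated ONCE in the shape the III-11a assembler and the normalisation-stability step (P3b) consume:

* `exists_galTwist_rescale`: a homomorphism `Ψ : LocalMp F N T v →* LocalMp F N (tT) v` over the IDENTITY on automorphisms of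
  `𝕎_v` with `ω(Ψ x) (B f) = B (ω(x) f)` for the `τ`-semilinear bijection `B = D_s ∘ (τ ∘ ·)` of `𝒮(F_vᴺ)`;
* `leviEquivSB_smulOfUnit_schwartzGalConj_apply_zero` (`(B f)(0) = τ (f 0)`) and `surjective_leviEquivSB_smulOfUnit_schwartzGalConj`
  — the two readings of `B` used by the Siegel-parabolic (value-at-the-origin) rigidity;
* `continuous_scaleInv` and `exists_section_galTwist_rescale`: a SMOOTH section `s₀` of `S̃p_{ψ_v}(𝕎_v, β_T)` over `ι^T_δ`
  yields a SMOOTH section `s₁` of `S̃p_{ψ_v}(𝕎_v, β_{tT})` over `ι^{tT}_δ` with `ω_{s₁}(scaleInl k) (B f) = B (ω_{s₀}(k) f)`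
  — «the `σ`-twist of the oscillator package of the line `⟨a⟩` is the oscillator package of the line `⟨t a⟩`, through `B`».

References: [MoeglinVignerasWaldspurger1987] Chap. 2 II.1, II Remarques (2)–(3), II.8; [GelbartRogawski1991] §3.1 p. 454;
[PlatonovRapinchuk1994] §5.1.
-/

set_option autoImplicit false

noncomputable section

open scoped Matrix
open NumberField IsDedekindDomain
open Literature.RepresentationTheory.HeisenbergGroup
open Literature.NumberTheory.Automorphic Literature.NumberTheory.Automorphic.UnitaryGroup

namespace Literature.NumberTheory.GelbartRogawski1991.UnitaryDualPair.LocalSplitting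

variable (F E : Type) [Field F] [NumberField F] [Field E] [NumberField E] [Algebra F E]
  [Algebra.IsQuadraticExtension F E] (c : E ≃ₐ[F] E) (N : ℕ)
  {δ : E} (hcδ : c δ = -δ) (hδ : δ ≠ 0) {d : F} (hd : δ * δ = algebraMap F E d)
  (T T' : Matrix (Fin N) (Fin N) F) (hT : T.IsSymm) (hT' : T'.IsSymm) (t : Fˣ) (hTT' : T' = (t : F) • T)
  {J J' : Matrix (Fin N) (Fin N) E} (hJ : J = T.map (algebraMap F E)) (hJ' : J' = T'.map (algebraMap F E))
  (v : HeightOneSpectrum (𝓞 F))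
  (τ τ' : ℂ →+* ℂ) (hττ' : ∀ z, τ (τ' z) = z) (hτ'τ : ∀ z, τ' (τ z) = z) (κ : v.adicCompletion F)
  (hκ : ∀ r : v.adicCompletion F, τ ((adeleAddCharAt F v r : Circle) : ℂ) = ((adeleAddCharAt F v (κ * r) : Circle) : ℂ))
  (s : (v.adicCompletion F)ˣ) (hκs : (s : v.adicCompletion F) * s * algebraMap F (v.adicCompletion F) (t : F) = κ)

/-! ## §1 The semilinear operator `B = D_s ∘ (τ ∘ ·)`: value at the origin, surjectivity -/

/-- **`(B f)(0) = τ (f 0)`** for `B = D_s ∘ (τ ∘ ·)`: the dilation does not move the origin.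
[cite: MoeglinVignerasWaldspurger1987, Chap. 2 II.1 (transport of structure)] -/
theorem leviEquivSB_smulOfUnit_schwartzGalConj_apply_zero (f : SchwartzBruhat (Fin N → v.adicCompletion F)) :
    ((leviEquivSB (LinearEquiv.smulOfUnit s) (continuous_const_smul (s : v.adicCompletion F))
        (continuous_const_smul ((s⁻¹ : (v.adicCompletion F)ˣ) : v.adicCompletion F)) (schwartzGalConj τ f) :
          SchwartzBruhat (Fin N → v.adicCompletion F)) : (Fin N → v.adicCompletion F) → ℂ) 0 =
      τ ((f : (Fin N → v.adicCompletion F) → ℂ) 0) := by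
  rw [coe_leviEquivSB_smulOfUnit_apply, smul_zero, schwartzGalConj_apply]

include τ' hττ' in
/-- **`B = D_s ∘ (τ ∘ ·)` is surjective** on `𝒮(F_vᴺ)` (`τ` has the inverse `τ′`, `D_s` is invertible).
[cite: MoeglinVignerasWaldspurger1987, Chap. 2 II.1 (transport of structure)] -/
theorem surjective_leviEquivSB_smulOfUnit_schwartzGalConj :
    Function.Surjective fun f : SchwartzBruhat (Fin N → v.adicCompletion F) =>
      leviEquivSB (LinearEquiv.smulOfUnit s) (continuous_const_smul (s : v.adicCompletion F))
        (continuous_const_smul ((s⁻¹ : (v.adicCompletion F)ˣ) : v.adicCompletion F)) (schwartzGalConj τ f) :=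
  (leviEquivSB (LinearEquiv.smulOfUnit s) (continuous_const_smul (s : v.adicCompletion F))
      (continuous_const_smul ((s⁻¹ : (v.adicCompletion F)ˣ) : v.adicCompletion F))).surjective.comp
    (schwartzGalConj_bijective τ τ' hττ').2

/-! ## §2 The composite `Ψ = (rescaling) ∘ (Galois twist) : LocalMp F N T v →* LocalMp F N (tT) v` -/

set_option maxHeartbeats 400000 in
include hTT' hττ' hτ'τ hκ hκs in
/-- **Galois twist followed by rescaling.**  For `τ ∘ ψ_v = ψ_v(κ·)` and `κ = s²·t` (`t ∈ Fˣ` global, `s ∈ F_vˣ`), `T′ = t•T`: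
there is a homomorphism `Ψ : S̃p_{ψ_v}(𝕎_v, β_T) →* S̃p_{ψ_v}(𝕎_v, β_{T′}) = LocalMp F N T′ v` which does not move the underlying
automorphism of `𝕎_v` and satisfies `ω(Ψ x) (B f) = B (ω(x) f)`, `B = D_s ∘ (τ ∘ ·)` (`Ψ = e ∘ galTwist`, `e` from
`exists_mpPsi_equiv_localMp_of_sq_mul_eq`). [cite: MoeglinVignerasWaldspurger1987, Chap. 2 II.1 (B) and II Remarques (2)–(3)] -/
theorem exists_galTwist_rescale :
    ∃ Ψ : LocalMp F N T v →* LocalMp F N T' v,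
      (∀ x, ((MpPsi.proj _ (Ψ x) : LocalSp F N T' v) :
          ((Fin N → v.adicCompletion F) × (Fin N → v.adicCompletion F)) ≃ₗ[v.adicCompletion F]
            ((Fin N → v.adicCompletion F) × (Fin N → v.adicCompletion F))) =
        (MpPsi.proj _ x : LocalSp F N T v)) ∧
      ∀ x (f : SchwartzBruhat (Fin N → v.adicCompletion F)),
        MpPsi.toRep (localSchrodinger F N T' v) (Ψ x)
            (leviEquivSB (LinearEquiv.smulOfUnit s) (continuous_const_smul (s : v.adicCompletion F))
              (continuous_const_smul ((s⁻¹ : (v.adicCompletion F)ˣ) : v.adicCompletion F)) (schwartzGalConj τ f)) =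
          leviEquivSB (LinearEquiv.smulOfUnit s) (continuous_const_smul (s : v.adicCompletion F))
            (continuous_const_smul ((s⁻¹ : (v.adicCompletion F)ˣ) : v.adicCompletion F))
            (schwartzGalConj τ (MpPsi.toRep (localSchrodinger F N T v) x f)) := by
  obtain ⟨e, he, he'⟩ := exists_mpPsi_equiv_localMp_of_sq_mul_eq F N T T' t hTT' v
    ((adeleAddCharAt F v).mulShift κ) (isLocallyConstant_adeleAddCharAt_mulShift F v κ)
    (continuous_localPairing_apply_left F N T v) κ s hκs (fun _ => rfl)
  refine ⟨e.toMonoidHom.comp (LocalMp.galTwist F N T v τ τ' hττ' hτ'τ κ hκ), fun x => ?_, fun x f => ?_⟩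
  · have h₁ := he (LocalMp.galTwist F N T v τ τ' hττ' hτ'τ κ hκ x)
    have h₂ := LocalMp.proj_galTwist F N T v τ τ' hττ' hτ'τ κ hκ x
    calc _ = ((MpPsi.proj _ (e (LocalMp.galTwist F N T v τ τ' hττ' hτ'τ κ hκ x)) : LocalSp F N T' v) :
          ((Fin N → v.adicCompletion F) × (Fin N → v.adicCompletion F)) ≃ₗ[v.adicCompletion F]
            ((Fin N → v.adicCompletion F) × (Fin N → v.adicCompletion F))) := rfl
      _ = _ := by rw [h₁]; exact congrArg Subtype.val h₂
  · have h₁ := he' (LocalMp.galTwist F N T v τ τ' hττ' hτ'τ κ hκ x) (schwartzGalConj τ f)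
    have h₂ := LocalMp.toRep_galTwist_schwartzGalConj F N T v τ τ' hττ' hτ'τ κ hκ x f
    calc _ = MpPsi.toRep (localSchrodinger F N T' v) (e (LocalMp.galTwist F N T v τ τ' hττ' hτ'τ κ hκ x))
          (leviEquivSB (LinearEquiv.smulOfUnit s) (continuous_const_smul (s : v.adicCompletion F))
            (continuous_const_smul ((s⁻¹ : (v.adicCompletion F)ˣ) : v.adicCompletion F)) (schwartzGalConj τ f)) := rfl
      _ = _ := by rw [h₁]; exact congrArg _ h₂

/-! ## §3 Sections over `ι`: smooth in, smooth out -/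

section Unitary

include hTT' in
omit [Algebra.IsQuadraticExtension F E] in
/-- `scaleInv : U(tJ)(F_v) → U(J)(F_v)` is continuous (identity on the ambient `Π_w GL_N(E_w)`). [cite: PlatonovRapinchuk1994, §5.1] -/
theorem continuous_scaleInv : Continuous (scaleInv F E c N T T' t hTT' hJ hJ' v) :=
  Continuous.subtype_mk (f := fun k : localPi E c N J' v => (k : LocalGLPi E N v)) continuous_subtype_val _

set_option maxHeartbeats 400000 in
include hTT' hττ' hτ'τ hκ hκs in
/-- **P3a ∘ P4 for smooth sections over `ι`.**  A homomorphism `s₀ : U(J)(F_v) →* S̃p_{ψ_v}(𝕎_v, β_T)` over `ι^T_δ` with smooth Weil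
representation `ω_{s₀}` yields `s₁ : U(tJ)(F_v) →* LocalMp F N (tT) v` over `ι^{tT}_δ`, again with SMOOTH Weil representation, and
`ω_{s₁}(scaleInl k) (B f) = B (ω_{s₀}(k) f)` for the `τ`-semilinear bijection `B = D_s ∘ (τ ∘ ·)` — the `σ`-twisted oscillator
package of `(T, δ)` is the oscillator package of `(tT, δ)`.  (`s₁ = e ∘ galTwist ∘ s₀ ∘ scaleInv`; smoothness through
`MpPsi.isSmooth_galTwist_comp` and `Representation.IsSmooth.of_equivariant_mulEquiv` along `(scaleInl, D_s)`.)
[cite: MoeglinVignerasWaldspurger1987, Chap. 2 II.1 (B), II.8 and II Remarques (2)–(3); GelbartRogawski1991, §3.1 p. 454] -/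
theorem exists_section_galTwist_rescale (s₀ : localPi E c N J v →* LocalMp F N T v)
    (hs₀ : ∀ k, MpPsi.proj _ (s₀ k) = iota F E c N hcδ hδ hd T hT hJ v k)
    (hsm : Representation.IsSmooth ((MpPsi.toRep (localSchrodinger F N T v)).comp s₀)) :
    ∃ s₁ : localPi E c N J' v →* LocalMp F N T' v,
      (∀ k', MpPsi.proj _ (s₁ k') = iota F E c N hcδ hδ hd T' hT' hJ' v k') ∧
      Representation.IsSmooth ((MpPsi.toRep (localSchrodinger F N T' v)).comp s₁) ∧
      ∀ (k : localPi E c N J v) (f : SchwartzBruhat (Fin N → v.adicCompletion F)),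
        MpPsi.toRep (localSchrodinger F N T' v) (s₁ (scaleInl F E c N T T' t hTT' hJ hJ' v k))
            (leviEquivSB (LinearEquiv.smulOfUnit s) (continuous_const_smul (s : v.adicCompletion F))
              (continuous_const_smul ((s⁻¹ : (v.adicCompletion F)ˣ) : v.adicCompletion F)) (schwartzGalConj τ f)) =
          leviEquivSB (LinearEquiv.smulOfUnit s) (continuous_const_smul (s : v.adicCompletion F))
            (continuous_const_smul ((s⁻¹ : (v.adicCompletion F)ˣ) : v.adicCompletion F))
            (schwartzGalConj τ (MpPsi.toRep (localSchrodinger F N T v) (s₀ k) f)) := by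
  -- P3a: twist the section
  obtain ⟨s', hs', hsm', hs'rep⟩ :=
    exists_galTwist_splitting F N T v τ τ' hττ' hτ'τ κ hκ E c hcδ hδ hd hT hJ s₀ hs₀ hsm
  -- P4: rescale the twisted section into `LocalMp F N T′ v`
  obtain ⟨s₁, hs₁, hs₁rep⟩ := exists_section_localMp_of_sq_mul_eq F E c N hcδ hδ hd T T' hT hT' t hTT' hJ hJ' v
    ((adeleAddCharAt F v).mulShift κ) (isLocallyConstant_adeleAddCharAt_mulShift F v κ)
    (continuous_localPairing_apply_left F N T v) κ s hκs (fun _ => rfl) s' hs'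
  have hrep : ∀ (k : localPi E c N J v) (f : SchwartzBruhat (Fin N → v.adicCompletion F)),
      MpPsi.toRep (localSchrodinger F N T' v) (s₁ (scaleInl F E c N T T' t hTT' hJ hJ' v k))
          (leviEquivSB (LinearEquiv.smulOfUnit s) (continuous_const_smul (s : v.adicCompletion F))
            (continuous_const_smul ((s⁻¹ : (v.adicCompletion F)ˣ) : v.adicCompletion F)) (schwartzGalConj τ f)) =
        leviEquivSB (LinearEquiv.smulOfUnit s) (continuous_const_smul (s : v.adicCompletion F))
          (continuous_const_smul ((s⁻¹ : (v.adicCompletion F)ˣ) : v.adicCompletion F))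
          (schwartzGalConj τ (MpPsi.toRep (localSchrodinger F N T v) (s₀ k) f)) := fun k f => by
    rw [hs₁rep k (schwartzGalConj τ f)]
    exact congrArg _ (hs'rep k f)
  refine ⟨s₁, hs₁, ?_, hrep⟩
  -- smoothness: transport along (scaleInl, D_s) from the (smooth) twisted section
  let φ : localPi E c N J v ≃ₜ* localPi E c N J' v :=
    { toFun := scaleInl F E c N T T' t hTT' hJ hJ' v
      invFun := scaleInv F E c N T T' t hTT' hJ hJ' v
      left_inv := scaleInv_scaleInl F E c N T T' t hTT' hJ hJ' v
      right_inv := scaleInl_scaleInv F E c N T T' t hTT' hJ hJ' v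
      map_mul' := map_mul _
      continuous_toFun := continuous_scaleInl F E c N T T' t hTT' hJ hJ' v
      continuous_invFun := continuous_scaleInv F E c N T T' t hTT' hJ hJ' v }
  refine Representation.IsSmooth.of_equivariant_mulEquiv
    (ρ := (MpPsi.toRep (localSchrodingerMulShift F N T v κ)).comp s')
    ((MpPsi.toRep (localSchrodinger F N T' v)).comp s₁) φ
    (leviEquivSB (LinearEquiv.smulOfUnit s) (continuous_const_smul (s : v.adicCompletion F))
      (continuous_const_smul ((s⁻¹ : (v.adicCompletion F)ˣ) : v.adicCompletion F)))
    (fun k g => ?_) hsm'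
  exact (hs₁rep k g).symm

end Unitary

end Literature.NumberTheory.GelbartRogawski1991.UnitaryDualPair.LocalSplitting

end
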